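import Summits.AtomisticToContinuum.BoseEinsteinCondensation.Theses.BECStronglyRayleigh
import Literature.Combinatorics.StablePolynomials.KernelForm
import Literature.Combinatorics.StablePolynomials.Limits
import Literature.MathematicalPhysics.QuantumLattice.LiebMattisLadder
import HarnessLib

/-!
# Variational selection in the stable cone: stub `stub_coneSelection` of line
# `stable-cone-variational-selection` for crux `GroundStateStability` (stmt-AtomisticToContinuum-9672)

Stub D ("the lever") of the skeleton
`Cruxes/GroundStateStability/Lines/stable-cone-variational-selection.lean`: a positive semidefinite
operator `T` on `ℓ²({0,1}^Λ)` which maps the cone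
`K_M = {φ ∈ sector M : φ entrywise real ≥ 0, Σ_S φ(1_S) z^S has no zero in H^Λ}` into itself has an
eigenvector in `K_M` (for a nonempty magnetisation sector `M`).

Proof (finite-dimensional linear algebra + multivariate Hurwitz).
* `K_M ∪ {0}` is closed: the sector is a (closed) subspace, entrywise nonnegativity is closed, and
  "stable or zero" is closed by the continuous-family Hurwitz theorem
  `eq_zero_or_isUpperHalfPlaneStable_of_mem_closure` applied to `φ ↦ multiAffine (S ↦ φ(1_S))`.
* `K_M` is nonempty: the basis vector `δ_{σ₀}` of a configuration `σ₀` in the support of the given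
  sector vector has occupation polynomial the monomial `z^{S₀}`.
* Hence `S₁ = K_M ∩ {‖φ‖ = 1}` is compact and nonempty, and `R(φ) = Re ⟨φ, Tφ⟩` has a maximiser
  `φ` on it. With `w = Tφ ∈ K_M` (so `w ≠ 0`), `a = ⟨φ,Tφ⟩ > 0`, `b = ⟨w,w⟩`, `c = ⟨w,Tw⟩`:
  maximality at `w/‖w‖` gives `c ≤ a b`, positivity of `⟨φ - t w, T(φ - t w)⟩` at `t = 1/a` gives
  `b ≤ a²`, and then `‖w - aφ‖² = b - a² ≤ 0`, i.e. `Tφ = aφ`.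
-/

noncomputable section

namespace Summit.AtomisticToContinuum.BoseEinsteinCondensation.Cruxes.GroundStateStability.StableConeVariationalSelection

open scoped BigOperators Matrix ComplexOrder ComplexConjugate
open Literature.MathematicalPhysics.QuantumLattice
open Literature.Combinatorics.StablePolynomials
open Matrix Finset

/-! ### Occupation indicators -/

/-- Every configuration `σ : Λ → Fin 2` is the occupation indicator `1_S` of `S = {x | σ x = 0}`.
[folklore] -/
theorem coneSel_indicator_filter_eq {Λ : Type*} [Fintype Λ] [DecidableEq Λ] (σ : Λ → Fin 2) :
    (fun x => if x ∈ Finset.univ.filter (fun x => σ x = 0) then (0 : Fin 2) else 1) = σ := by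
  funext x
  simp only [Finset.mem_filter, Finset.mem_univ, true_and]
  generalize σ x = a
  fin_cases a <;> simp

/-- `1_S = σ` iff `S = {x | σ x = 0}`. [folklore] -/
theorem coneSel_indicator_eq_iff {Λ : Type*} [Fintype Λ] [DecidableEq Λ] (S : Finset Λ)
    (σ : Λ → Fin 2) :
    (fun x => if x ∈ S then (0 : Fin 2) else 1) = σ ↔ S = Finset.univ.filter (fun x => σ x = 0) := by
  constructor
  · rintro rfl
    ext x
    simp only [Finset.mem_filter, Finset.mem_univ, true_and]
    by_cases hx : x ∈ S <;> simp [hx]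
  · rintro rfl
    exact coneSel_indicator_filter_eq σ

/-! ### The occupation sum: scaling, the zero vector, basis vectors, closedness of "stable or zero" -/

/-- The occupation sum is linear in the coefficient vector: scaling. [folklore] -/
theorem coneSel_occ_smul {Λ : Type*} [Fintype Λ] [DecidableEq Λ] (c : ℂ) (φ : TensorIndex Λ 2 → ℂ)
    (z : Λ → ℂ) :
    (∑ S : Finset Λ, (c • φ) (fun i => if i ∈ S then 0 else 1) * ∏ i ∈ S, z i) =
      c * ∑ S : Finset Λ, φ (fun i => if i ∈ S then 0 else 1) * ∏ i ∈ S, z i := by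
  simp only [Pi.smul_apply, smul_eq_mul, mul_assoc, Finset.mul_sum]

/-- A vector with zero-free occupation polynomial is nonzero (evaluate at `z ≡ i`). [folklore] -/
theorem coneSel_ne_zero_of_stable {Λ : Type*} [Fintype Λ] [DecidableEq Λ] {φ : TensorIndex Λ 2 → ℂ}
    (hφ : ∀ z : Λ → ℂ, (∀ i, 0 < (z i).im) →
      (∑ S : Finset Λ, φ (fun i => if i ∈ S then 0 else 1) * ∏ i ∈ S, z i) ≠ 0) : φ ≠ 0 := by
  rintro rfl
  exact hφ (fun _ => Complex.I) (fun _ => by simp) (by simp)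

/-- The occupation polynomial of the basis vector `δ_{σ₀}` is the monomial `∏_{x : σ₀ x = 0} z_x`.
[folklore] -/
theorem coneSel_occ_single {Λ : Type*} [Fintype Λ] [DecidableEq Λ] (σ₀ : TensorIndex Λ 2)
    {e : TensorIndex Λ 2 → ℂ} (he : ∀ σ, e σ = if σ = σ₀ then 1 else 0) (z : Λ → ℂ) :
    (∑ S : Finset Λ, e (fun i => if i ∈ S then 0 else 1) * ∏ i ∈ S, z i) =
      ∏ i ∈ Finset.univ.filter (fun x => σ₀ x = 0), z i := by
  simp_rw [he, coneSel_indicator_eq_iff, boole_mul]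
  rw [Finset.sum_ite_eq' Finset.univ (Finset.univ.filter (fun x => σ₀ x = 0))]
  simp

/-- **"Stable or zero" is a closed condition on the coefficient vector** (multivariate Hurwitz in the
continuous-family form `eq_zero_or_isUpperHalfPlaneStable_of_mem_closure`, applied to
`φ ↦ Σ_S φ(1_S) z^S`; a vanishing coefficient form has all `φ(1_S) = 0`, hence `φ = 0` because every
configuration is some `1_S`). [cite: Wagner2011, §2 (Hurwitz's Theorem)] -/
theorem coneSel_isClosed_zero_or_stable (Λ : Type*) [Fintype Λ] [DecidableEq Λ] :
    IsClosed {φ : TensorIndex Λ 2 → ℂ | φ = 0 ∨ ∀ z : Λ → ℂ, (∀ i, 0 < (z i).im) →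
      (∑ S : Finset Λ, φ (fun i => if i ∈ S then 0 else 1) * ∏ i ∈ S, z i) ≠ 0} := by
  refine closure_subset_iff_isClosed.mp ?_
  intro q hq
  rw [Set.setOf_or, Set.setOf_eq_eq_singleton, closure_union, closure_singleton] at hq
  rcases hq with hq | hq
  · exact Or.inl hq
  · have hP : Continuous fun az : (TensorIndex Λ 2 → ℂ) × (Λ → ℂ) =>
        MvPolynomial.eval az.2 (multiAffine fun S : Finset Λ =>
          az.1 (fun i => if i ∈ S then 0 else 1)) := by
      simp only [eval_multiAffine]
      fun_prop
    have h := eq_zero_or_isUpperHalfPlaneStable_of_mem_closure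
      (P := fun φ : TensorIndex Λ 2 → ℂ => multiAffine fun S : Finset Λ =>
        φ (fun i => if i ∈ S then 0 else 1)) hP
      (s := {φ : TensorIndex Λ 2 → ℂ | ∀ z : Λ → ℂ, (∀ i, 0 < (z i).im) →
        (∑ S : Finset Λ, φ (fun i => if i ∈ S then 0 else 1) * ∏ i ∈ S, z i) ≠ 0})
      (fun a ha => (isUpperHalfPlaneStable_multiAffine_iff _).mpr ha) hq
    rcases h with h0 | hst
    · refine Or.inl ?_
      rw [multiAffine_eq_zero_iff] at h0
      funext σ
      have := h0 (Finset.univ.filter fun x => σ x = 0)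
      rwa [coneSel_indicator_filter_eq] at this
    · exact Or.inr ((isUpperHalfPlaneStable_multiAffine_iff _).mp hst)

/-! ### Hermitian linear algebra -/

/-- Sesquilinear expansion of `⟨x - c y, u - c v⟩`. [folklore] -/
theorem coneSel_expand {ι : Type*} [Fintype ι] (x y u v : ι → ℂ) (c : ℂ) :
    star (x - c • y) ⬝ᵥ (u - c • v) =
      star x ⬝ᵥ u - c * (star x ⬝ᵥ v) - star c * (star y ⬝ᵥ u) + star c * c * (star y ⬝ᵥ v) := by
  simp only [star_sub, star_smul, sub_dotProduct, dotProduct_sub, smul_dotProduct, dotProduct_smul,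
    smul_eq_mul]
  ring

/-- Normalisation by a *positive real* scalar: a nonzero vector has a unit positive multiple.
[folklore] -/
theorem coneSel_exists_unit_smul {ι : Type*} [Fintype ι] {v : ι → ℂ} (hv : v ≠ 0) :
    ∃ r : ℝ, 0 < r ∧ star ((r : ℂ) • v) ⬝ᵥ ((r : ℂ) • v) = 1 := by
  -- adapted from Literature/MathematicalPhysics/QuantumLattice/SectorSpectrum.lean `exists_smul_unit`
  have hpos : 0 < star v ⬝ᵥ v := Matrix.dotProduct_star_self_pos_iff.2 hv
  obtain ⟨hre, him⟩ := Complex.pos_iff.mp hpos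
  set b := (star v ⬝ᵥ v).re with hb
  have hvv : star v ⬝ᵥ v = (b : ℂ) := Complex.ext (by simp [hb]) (by simp [← him])
  refine ⟨(Real.sqrt b)⁻¹, inv_pos.2 (Real.sqrt_pos.2 hre), ?_⟩
  rw [star_smul, smul_dotProduct, dotProduct_smul, hvv, Complex.star_def, Complex.conj_ofReal,
    smul_eq_mul, smul_eq_mul, ← mul_assoc]
  have h : (Real.sqrt b)⁻¹ * (Real.sqrt b)⁻¹ * b = 1 := by
    rw [← mul_inv, Real.mul_self_sqrt hre.le, inv_mul_cancel₀ hre.ne']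
  exact_mod_cast h

/-- **The moment chain.** Let `T` be positive semidefinite, `φ` a unit vector with `Tφ ≠ 0`, and
suppose the Rayleigh quotient at the normalised `Tφ` does not exceed the one at `φ`. Then `φ` is an
eigenvector: with `a = ⟨φ,Tφ⟩`, `b = ⟨Tφ,Tφ⟩`, `c = ⟨Tφ,T²φ⟩` one has `c ≤ ab` (hypothesis),
`0 ≤ ⟨φ - tTφ, T(φ - tTφ)⟩ = a - 2tb + t²c` at `t = 1/a` gives `b ≤ a²`, and
`‖Tφ - aφ‖² = b - a² ≤ 0`. [folklore] -/
theorem coneSel_eigen_of_maximal {ι : Type*} [Fintype ι] {T : Matrix ι ι ℂ} (hT : T.PosSemidef)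
    {φ : ι → ℂ} (hφ1 : star φ ⬝ᵥ φ = 1) (hw0 : T *ᵥ φ ≠ 0)
    (hmax : ∀ r : ℝ, 0 < r → star ((r : ℂ) • T *ᵥ φ) ⬝ᵥ ((r : ℂ) • T *ᵥ φ) = 1 →
      (star ((r : ℂ) • T *ᵥ φ) ⬝ᵥ T *ᵥ ((r : ℂ) • T *ᵥ φ)).re ≤ (star φ ⬝ᵥ T *ᵥ φ).re) :
    T *ᵥ φ = (((star φ ⬝ᵥ T *ᵥ φ).re : ℝ) : ℂ) • φ := by
  have hH : Tᴴ = T := hT.1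
  have h1 : 0 ≤ star φ ⬝ᵥ T *ᵥ φ := hT.dotProduct_mulVec_nonneg φ
  have hcrossT : star φ ⬝ᵥ T *ᵥ (T *ᵥ φ) = star (T *ᵥ φ) ⬝ᵥ (T *ᵥ φ) := by
    rw [star_mulVec, hH, ← dotProduct_mulVec]
  generalize hw : T *ᵥ φ = w at hmax hw0 h1 hcrossT ⊢
  -- the three moments are real: `a = ⟨φ,w⟩ ≥ 0`, `b = ⟨w,w⟩ > 0`, `c = ⟨w,Tw⟩ ≥ 0`
  set a := (star φ ⬝ᵥ w).re with ha
  have hm1 : star φ ⬝ᵥ w = (a : ℂ) :=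
    Complex.ext (by simp [ha]) (by simpa using (Complex.nonneg_iff.mp h1).2.symm)
  have h2 : 0 < star w ⬝ᵥ w := Matrix.dotProduct_star_self_pos_iff.2 hw0
  set b := (star w ⬝ᵥ w).re with hb
  have hm2 : star w ⬝ᵥ w = (b : ℂ) :=
    Complex.ext (by simp [hb]) (by simpa using (Complex.pos_iff.mp h2).2.symm)
  have hb0 : 0 < b := (Complex.pos_iff.mp h2).1
  have h3 : 0 ≤ star w ⬝ᵥ T *ᵥ w := hT.dotProduct_mulVec_nonneg w
  set c := (star w ⬝ᵥ T *ᵥ w).re with hc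
  have hm3 : star w ⬝ᵥ T *ᵥ w = (c : ℂ) :=
    Complex.ext (by simp [hc]) (by simpa using (Complex.nonneg_iff.mp h3).2.symm)
  have hc0 : 0 ≤ c := (Complex.nonneg_iff.mp h3).1
  -- cross terms (`T` Hermitian, `φ`, `w` arbitrary)
  have hcross : star φ ⬝ᵥ T *ᵥ w = (b : ℂ) := by rw [hcrossT, hm2]
  have hcross' : star w ⬝ᵥ φ = (a : ℂ) := by
    rw [star_dotProduct, hm1, Complex.star_def, Complex.conj_ofReal]
  -- `a > 0`: otherwise `⟨φ,Tφ⟩ = 0`, so `Tφ = 0`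
  have ha0 : 0 < a := by
    rcases (Complex.nonneg_iff.mp h1).1.eq_or_lt with h | h
    · exfalso
      apply hw0
      rw [← hw, ← hT.dotProduct_mulVec_zero_iff, hw, hm1, ha, ← h, Complex.ofReal_zero]
    · exact h
  -- maximality at the normalised `w`: `c ≤ a b`
  have hcab : c ≤ a * b := by
    set r := (Real.sqrt b)⁻¹ with hr
    have hr0 : 0 < r := inv_pos.2 (Real.sqrt_pos.2 hb0)
    have hrr : r * r * b = 1 := by
      rw [hr, ← mul_inv, Real.mul_self_sqrt hb0.le, inv_mul_cancel₀ hb0.ne']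
    have hunit : star ((r : ℂ) • w) ⬝ᵥ ((r : ℂ) • w) = 1 := by
      rw [star_smul, smul_dotProduct, dotProduct_smul, hm2, Complex.star_def, Complex.conj_ofReal,
        smul_eq_mul, smul_eq_mul, ← mul_assoc]
      exact_mod_cast hrr
    have hval : star ((r : ℂ) • w) ⬝ᵥ T *ᵥ ((r : ℂ) • w) = ((r * r * c : ℝ) : ℂ) := by
      rw [mulVec_smul, star_smul, smul_dotProduct, dotProduct_smul, hm3, Complex.star_def,
        Complex.conj_ofReal, smul_eq_mul, smul_eq_mul, ← mul_assoc]
      push_cast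
      ring
    have h := hmax r hr0 hunit
    rw [hval, Complex.ofReal_re] at h
    calc c = (r * r * b) * c := by rw [hrr, one_mul]
      _ = (r * r * c) * b := by ring
      _ ≤ a * b := mul_le_mul_of_nonneg_right h hb0.le
  -- positivity of the form at `φ - t w`, `t = 1/a`: `b ≤ a²`
  have hquad : ∀ t : ℝ, 0 ≤ a - 2 * t * b + t ^ 2 * c := by
    intro t
    have h0 := hT.dotProduct_mulVec_nonneg (φ - (t : ℂ) • w)
    have hexp : star (φ - (t : ℂ) • w) ⬝ᵥ T *ᵥ (φ - (t : ℂ) • w) =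
        ((a - 2 * t * b + t ^ 2 * c : ℝ) : ℂ) := by
      rw [mulVec_sub, mulVec_smul, hw, coneSel_expand, hm1, hcross, hm2, hm3, Complex.star_def,
        Complex.conj_ofReal]
      push_cast
      ring
    rw [hexp] at h0
    exact_mod_cast h0
  have hba : b ≤ a ^ 2 := by
    have hq := hquad a⁻¹
    have hq' : 0 ≤ a ^ 2 * (a - 2 * a⁻¹ * b + a⁻¹ ^ 2 * c) := mul_nonneg (sq_nonneg a) hq
    have heq : a ^ 2 * (a - 2 * a⁻¹ * b + a⁻¹ ^ 2 * c) = a ^ 3 - 2 * a * b + c := by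
      field_simp
    rw [heq] at hq'
    nlinarith [hq', hcab, ha0]
  -- `‖w - aφ‖² = b - a² ≤ 0`
  have hv : star (w - (a : ℂ) • φ) ⬝ᵥ (w - (a : ℂ) • φ) = ((b - a ^ 2 : ℝ) : ℂ) := by
    rw [coneSel_expand, hm2, hcross', hm1, hφ1, Complex.star_def, Complex.conj_ofReal]
    push_cast
    ring
  have hv0 : 0 ≤ star (w - (a : ℂ) • φ) ⬝ᵥ (w - (a : ℂ) • φ) := dotProduct_star_self_nonneg _
  rw [hv] at hv0
  have hba' : 0 ≤ b - a ^ 2 := by exact_mod_cast hv0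
  have hzero : b - a ^ 2 = 0 := le_antisymm (by linarith) hba'
  have : w - (a : ℂ) • φ = 0 := by
    rw [← dotProduct_star_self_eq_zero, hv, hzero, Complex.ofReal_zero]
  exact sub_eq_zero.mp this

/-! ### The stub -/

/-- **Stub D — the lever: variational selection in the stable cone.** Let `T` be a positive
semidefinite operator on `ℓ²({0,1}^Λ)` and `M` a nonempty magnetisation sector. If `T` maps the cone
`K_M = {φ ∈ sector M : φ entrywise real ≥ 0, Σ_S φ(1_S) z^S is H^Λ-stable}` into itself, then `T` has
an eigenvector in `K_M`: maximise `Re ⟨φ, Tφ⟩` over the compact set `K_M ∩ {‖φ‖ = 1}` (closed by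
Hurwitz, `coneSel_isClosed_zero_or_stable`; nonempty by a basis vector, whose occupation polynomial
is a monomial) and run the moment chain `coneSel_eigen_of_maximal`. [folklore] -/
theorem stub_coneSelection :
    ∀ (Λ : Type) [Fintype Λ] [DecidableEq Λ] (M : ℝ) (T : Op Λ 2),
      T.PosSemidef →
      (∃ ψ : TensorIndex Λ 2 → ℂ, ψ ∈ spinZSector 1 M ∧ ψ ≠ 0) →
      (∀ φ : TensorIndex Λ 2 → ℂ, φ ∈ spinZSector 1 M →
        (∀ σ : TensorIndex Λ 2, 0 ≤ (φ σ).re ∧ (φ σ).im = 0) →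
        (∀ z : Λ → ℂ, (∀ i, 0 < (z i).im) →
          (∑ S : Finset Λ, φ (fun i => if i ∈ S then 0 else 1) * ∏ i ∈ S, z i) ≠ 0) →
        (T *ᵥ φ ∈ spinZSector 1 M ∧
          (∀ σ : TensorIndex Λ 2, 0 ≤ ((T *ᵥ φ) σ).re ∧ ((T *ᵥ φ) σ).im = 0) ∧
          (∀ z : Λ → ℂ, (∀ i, 0 < (z i).im) →
          (∑ S : Finset Λ, (T *ᵥ φ) (fun i => if i ∈ S then 0 else 1) * ∏ i ∈ S, z i) ≠ 0))) →
      ∃ φ : TensorIndex Λ 2 → ℂ, φ ∈ spinZSector 1 M ∧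
        (∀ σ : TensorIndex Λ 2, 0 ≤ (φ σ).re ∧ (φ σ).im = 0) ∧
        (∀ z : Λ → ℂ, (∀ i, 0 < (z i).im) →
          (∑ S : Finset Λ, φ (fun i => if i ∈ S then 0 else 1) * ∏ i ∈ S, z i) ≠ 0) ∧
        ∃ c : ℝ, T *ᵥ φ = (c : ℂ) • φ := by
  intro Λ _ _ M T hT hne hK
  obtain ⟨ψ, hψ, hψ0⟩ := hne
  -- positive real scalings preserve the three cone conditions
  have hsmul_nn : ∀ (r : ℝ), 0 < r → ∀ φ : TensorIndex Λ 2 → ℂ,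
      (∀ σ, 0 ≤ (φ σ).re ∧ (φ σ).im = 0) →
      ∀ σ, 0 ≤ (((r : ℂ) • φ) σ).re ∧ (((r : ℂ) • φ) σ).im = 0 := by
    intro r hr φ hφ σ
    simp only [Pi.smul_apply, smul_eq_mul, Complex.re_ofReal_mul, Complex.im_ofReal_mul]
    exact ⟨mul_nonneg hr.le (hφ σ).1, by rw [(hφ σ).2, mul_zero]⟩
  have hsmul_st : ∀ (r : ℝ), 0 < r → ∀ φ : TensorIndex Λ 2 → ℂ,
      (∀ z : Λ → ℂ, (∀ i, 0 < (z i).im) →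
        (∑ S : Finset Λ, φ (fun i => if i ∈ S then 0 else 1) * ∏ i ∈ S, z i) ≠ 0) →
      ∀ z : Λ → ℂ, (∀ i, 0 < (z i).im) →
        (∑ S : Finset Λ, ((r : ℂ) • φ) (fun i => if i ∈ S then 0 else 1) * ∏ i ∈ S, z i) ≠ 0 := by
    intro r hr φ hφ z hz
    rw [coneSel_occ_smul]
    exact mul_ne_zero (by exact_mod_cast hr.ne') (hφ z hz)
  -- the seed: a basis vector of the sector
  obtain ⟨σ₀, hσ₀⟩ : ∃ σ, ψ σ ≠ 0 := Function.ne_iff.mp hψ0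
  have hmag := (LiebMattis.mem_spinZSector_iff 1 M ψ).mp hψ σ₀ hσ₀
  obtain ⟨e, he⟩ : ∃ e : TensorIndex Λ 2 → ℂ, ∀ σ, e σ = if σ = σ₀ then 1 else 0 :=
    ⟨_, fun _ => rfl⟩
  have he0 : e ≠ 0 := fun h => by simpa [he] using congrFun h σ₀
  have he_sec : e ∈ spinZSector 1 M := by
    refine (LiebMattis.mem_spinZSector_iff 1 M e).mpr fun σ hσ => ?_
    obtain rfl : σ = σ₀ := by
      by_contra h
      exact hσ (by rw [he, if_neg h])
    exact hmag
  have he_nn : ∀ σ, 0 ≤ (e σ).re ∧ (e σ).im = 0 := by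
    intro σ
    rw [he]
    split_ifs <;> simp
  have he_st : ∀ z : Λ → ℂ, (∀ i, 0 < (z i).im) →
      (∑ S : Finset Λ, e (fun i => if i ∈ S then 0 else 1) * ∏ i ∈ S, z i) ≠ 0 := by
    intro z hz
    rw [coneSel_occ_single σ₀ he z]
    exact Finset.prod_ne_zero_iff.mpr fun i _ h => (hz i).ne' (by rw [h, Complex.zero_im])
  -- the compact section `S₁ = K ∩ {‖φ‖ = 1}` (with "stable" relaxed to "stable or zero")
  set S₁ : Set (TensorIndex Λ 2 → ℂ) :=
    ({φ : TensorIndex Λ 2 → ℂ | φ ∈ spinZSector 1 M} ∩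
      {φ | ∀ σ, 0 ≤ (φ σ).re ∧ (φ σ).im = 0}) ∩
      {φ | φ = 0 ∨ ∀ z : Λ → ℂ, (∀ i, 0 < (z i).im) →
        (∑ S : Finset Λ, φ (fun i => if i ∈ S then 0 else 1) * ∏ i ∈ S, z i) ≠ 0} ∩
      {φ | star φ ⬝ᵥ φ = 1} with hS₁
  have hmemS₁ : ∀ (r : ℝ), 0 < r → ∀ φ : TensorIndex Λ 2 → ℂ, φ ∈ spinZSector 1 M →
      (∀ σ, 0 ≤ (φ σ).re ∧ (φ σ).im = 0) →
      (∀ z : Λ → ℂ, (∀ i, 0 < (z i).im) →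
        (∑ S : Finset Λ, φ (fun i => if i ∈ S then 0 else 1) * ∏ i ∈ S, z i) ≠ 0) →
      star ((r : ℂ) • φ) ⬝ᵥ ((r : ℂ) • φ) = 1 → (r : ℂ) • φ ∈ S₁ := by
    intro r hr φ h1 h2 h3 h4
    exact ⟨⟨⟨(spinZSector 1 M).smul_mem (r : ℂ) h1, hsmul_nn r hr φ h2⟩,
      Or.inr (hsmul_st r hr φ h3)⟩, h4⟩
  have hclosed : IsClosed S₁ := by
    refine ((?_ : IsClosed _).inter ?_).inter (coneSel_isClosed_zero_or_stable Λ) |>.inter ?_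
    · exact (spinZSector 1 M).closed_of_finiteDimensional
    · rw [Set.setOf_forall]
      exact isClosed_iInter fun σ =>
        (isClosed_le continuous_const (Complex.continuous_re.comp (continuous_apply σ))).and
          (isClosed_eq (Complex.continuous_im.comp (continuous_apply σ)) continuous_const)
    · exact isClosed_eq (continuous_star.dotProduct continuous_id) continuous_const
  have hnorm : ∀ φ : TensorIndex Λ 2 → ℂ, star φ ⬝ᵥ φ = 1 → ‖φ‖ ≤ 1 := by
    intro φ hφ
    have hsum : (star φ ⬝ᵥ φ).re = ∑ τ, ‖φ τ‖ ^ 2 := by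
      simp only [dotProduct, Pi.star_apply, Complex.star_def, Complex.conj_mul', Complex.re_sum]
      exact Finset.sum_congr rfl fun τ _ => by norm_cast
    refine (pi_norm_le_iff_of_nonneg zero_le_one).2 fun σ => ?_
    have hσ : ‖φ σ‖ ^ 2 ≤ 1 := by
      calc ‖φ σ‖ ^ 2 ≤ ∑ τ, ‖φ τ‖ ^ 2 :=
            Finset.single_le_sum (fun τ _ => sq_nonneg ‖φ τ‖) (Finset.mem_univ σ)
        _ = 1 := by rw [← hsum, hφ, Complex.one_re]
    nlinarith [norm_nonneg (φ σ)]
  have hbdd : Bornology.IsBounded S₁ := by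
    refine (Metric.isBounded_iff_subset_closedBall 0).2 ⟨1, fun φ hφ => ?_⟩
    rw [Metric.mem_closedBall, dist_zero_right]
    exact hnorm φ hφ.2
  have hcompact : IsCompact S₁ := Metric.isCompact_of_isClosed_isBounded hclosed hbdd
  have hnonempty : S₁.Nonempty := by
    obtain ⟨r, hr, hr1⟩ := coneSel_exists_unit_smul he0
    exact ⟨_, hmemS₁ r hr e he_sec he_nn he_st hr1⟩
  have hcont : Continuous fun φ : TensorIndex Λ 2 → ℂ => (star φ ⬝ᵥ T *ᵥ φ).re :=
    Complex.continuous_re.comp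
      (continuous_star.dotProduct (continuous_const.matrix_mulVec continuous_id))
  obtain ⟨φ, hφS, hφmax⟩ := hcompact.exists_isMaxOn hnonempty hcont.continuousOn
  obtain ⟨⟨⟨hsec, hnn⟩, hzs⟩, hsph⟩ := hφS
  simp only [Set.mem_setOf_eq] at hsec hnn hzs hsph
  have hst : ∀ z : Λ → ℂ, (∀ i, 0 < (z i).im) →
      (∑ S : Finset Λ, φ (fun i => if i ∈ S then 0 else 1) * ∏ i ∈ S, z i) ≠ 0 := by
    refine hzs.resolve_left fun h => ?_
    rw [h, star_zero, dotProduct_zero] at hsph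
    exact zero_ne_one hsph
  obtain ⟨hTsec, hTnn, hTst⟩ := hK φ hsec hnn hst
  have hw0 : T *ᵥ φ ≠ 0 := coneSel_ne_zero_of_stable hTst
  refine ⟨φ, hsec, hnn, hst, (star φ ⬝ᵥ T *ᵥ φ).re, coneSel_eigen_of_maximal hT hsph hw0 ?_⟩
  intro r hr hr1
  exact (isMaxOn_iff.mp hφmax) _ (hmemS₁ r hr (T *ᵥ φ) hTsec hTnn hTst hr1)

end Summit.AtomisticToContinuum.BoseEinsteinCondensation.Cruxes.GroundStateStability.StableConeVariationalSelection
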